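import Literature.AlgebraicGeometry.HodgeTheory.MotivatedClassesDeformationLeaves
import Literature.AlgebraicGeometry.HodgeTheory.MotivatedClassesDeformationCurves
import Literature.AlgebraicGeometry.HodgeTheory.SmoothProjectiveCompactificationProofs
import Literature.AlgebraicGeometry.Motives.CurveThroughTwoPointsProofs
import HarnessLib

/-!
# Route HeckePrymWeil — crux `SummitOffWeilSector` (stmt-HodgeConjecture-14374), line
`motivated-anchor-split`, stub `stub_andreDeformation`: André's deformation theorem modulo its
three open leaves

The stub `stub_andreDeformation : Andre1996_deformation` of the line skeleton
(`Cruxes/SummitOffWeilSector/Lines/motivated_anchor_split.lean`) is André's deformation theorem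
(Y. André, *Pour une théorie inconditionnelle des motifs*, Publ. Math. IHÉS 83 (1996), Thm. 0.5, in
global-class form on the real carriers; the tree's named fact `Andre1996_deformation`,
`HodgeTheory/MotivatedClasses`). The tree proves the ARCHITECTURE of André's §5.1 proof
(`Andre1996_deformation_holds_of`, `HodgeTheory/MotivatedClassesDeformationLeaves`;
`Andre1996_deformation_of_four_inputs`, `HodgeTheory/MotivatedClassesDeformationCurves`) from five
published inputs:

* (A0) the curve lemma on affine varieties (`Mumford_curveLemma_affine`) — DISCHARGED in the tree
  from Mumford's lemma `Motives.mumford_smoothCurve_through_two_points`, itself PROVED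
  (`Motives.mumford_smoothCurve_through_two_points_holds`, `Motives/CurveThroughTwoPointsProofs`);
* (A1) Hironaka's smooth compactification (`Hironaka1964_smoothCompactification`) — PROVED
  (`Hironaka1964_smoothCompactification_holds`, `HodgeTheory/SmoothProjectiveCompactificationProofs`,
  from the tree's strong projective resolution; unconditional);
* (A2) Deligne's théorème de la partie fixe (`deligne_globalInvariantCycles`) — OPEN (reduced in
  the tree to Voisin II Thm. 4.18 pointwise, Deligne's mixed Hodge structures
  `MixedHodgeStructureOfPair.existsDeligne` and Hodge II Cor. 3.2.17,
  `deligne_globalInvariantCycles_of_thm418_of_cor3217`);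
* (A3) André's Thm. 0.4 in its §5.1 form (`Andre1996_exists_motivated_of_motivated_pullback`) —
  OPEN (semisimplicity of motivated motives);
* (A5) André's Prop. 2.1 (ii) (`Andre1996_motivatedClasses_pullback`: motivated classes are stable
  under pull-back along morphisms of smooth projective varieties) — OPEN.

This file records the resulting CONDITIONAL reduction of the stub to the three open leaves, with
(A0) and (A1) discharged by their proofs:

* `andreDeformation_of_three_leaves : deligne_globalInvariantCycles →
  Andre1996_exists_motivated_of_motivated_pullback → Andre1996_motivatedClasses_pullback →
  Andre1996_deformation`.

No definition and no named fact is introduced; the three open leaves are the tree's EXISTING named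
facts, taken as explicit hypotheses.

## References

* [Andre1996Motifs] Y. André, Pour une théorie inconditionnelle des motifs, Publ. Math. IHÉS 83
  (1996): Thm. 0.4 (p. 7), Thm. 0.5 (p. 8), Prop. 2.1 (p. 15), §5.1 (p. 25).
* [MumfordAV1970] D. Mumford, Abelian Varieties (1970), §6, Lemma (p. 56).
* [Hironaka1964] H. Hironaka, Ann. of Math. 79 (1964), Main Theorem I.
* [DeligneHodgeII1971] P. Deligne, Théorie de Hodge II, Publ. Math. IHÉS 40 (1971), Thm. 4.1.1.
-/

noncomputable section

-- every declaration of this problem lives in `Summit.HodgeConjecture.HodgeConjecture.…` (summit = sub-problem)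
set_option linter.dupNamespace false

open CategoryTheory AlgebraicGeometry
open Literature.AlgebraicGeometry.Motives Literature.AlgebraicGeometry.HodgeTheory

namespace Summit.HodgeConjecture.HodgeConjecture.Theorems

/-- **André's deformation theorem (Thm. 0.5) from its three open leaves.** The §5.1 assembly
`Andre1996_deformation_holds_of` with its curve input (A0) discharged by Mumford's lemma
(`Andre1996_deformation_hcurve` applied to the PROVED `Motives.mumford_smoothCurve_through_two_points_holds`)
and its compactification input (A1) discharged by the PROVED
`Hironaka1964_smoothCompactification_holds`. Remaining hypotheses, each an existing named fact of
the tree taken verbatim: `hD` (A2, Deligne's théorème de la partie fixe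
`deligne_globalInvariantCycles`), `h04` (A3, André's Thm. 0.4 in the form used in §5.1,
`Andre1996_exists_motivated_of_motivated_pullback`), `h21` (A5, André's Prop. 2.1 (ii),
`Andre1996_motivatedClasses_pullback`).
[cite: Andre1996Motifs, Thm. 0.5 (p. 8) and §5.1 (p. 25)] [cite: MumfordAV1970, §6 Lemma (p. 56)]
[cite: Hironaka1964, Main Theorem I] -/
theorem andreDeformation_of_three_leaves :
    deligne_globalInvariantCycles → Andre1996_exists_motivated_of_motivated_pullback →
      Andre1996_motivatedClasses_pullback → Andre1996_deformation :=
  fun hD h04 h21 =>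
    Andre1996_deformation_holds_of
      (Andre1996_deformation_hcurve mumford_smoothCurve_through_two_points_holds)
      Hironaka1964_smoothCompactification_holds hD h04 h21

end Summit.HodgeConjecture.HodgeConjecture.Theorems

end
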